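import Literature.AlgebraicGeometry.Surfaces.K3TwoZeroLine
import Literature.AlgebraicGeometry.HodgeTheory.CupPreservesHodgeTypeOfDeRham
import Literature.AlgebraicGeometry.HodgeTheory.HypersurfaceHolomorphicFormsProofs
import Literature.NumberTheory.Transcendental.DeRhamTheoremMultiplicative
import HarnessLib

/-!
# The Hodge types on `H²` of a K3 surface: the Hodge–Riemann inequality `σ̄ ∪ σ ≠ 0` and the discharge of `Huybrechts_K3_hodgeTypes_H2`

We prove the last input of `Huybrechts_K3_hodgeTypes_H2` (Huybrechts, *Lectures on K3 Surfaces*,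
Ch. 6 Prop. 1.2 (ii) / Ch. 3 Example 1.7 (ii): for `0 ≠ σ ∈ H^{2,0}` of a K3 surface, `(σ.σ̄) = ∫ σ ∧ σ̄ > 0`), in
the sign-free form `σ̄ ∪ σ ≠ 0 ∈ H⁴(S(ℂ); ℂ)` used by the tree
(`IsK3Surface.cupProduct_conjClass_self_ne_zero`), and discharge the named fact
(`Huybrechts_K3_hodgeTypes_H2_holds`).

Proof. Read `σ` in the Hodge model `A` of `S` carrying the nowhere-vanishing holomorphic `2`-form
`η` (`IsK3Surface`), with the REAL and MULTIPLICATIVE comparison `(e ⊗ ℂ)`,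
`e = integrationDeRhamIsoFamily` (`DeRhamIsoFamily.complexify_isReal`,
`integrationDeRhamIsoFamily_isMultiplicative`):
the pull-back of `σ` is `(e ⊗ ℂ)[s η]` with `s ≠ 0` (`H^{2,0} = ℂ[η]`, `TwoForms.exists_eq_const_smul`),
that of `σ̄` is `(e ⊗ ℂ)[s̄ η̄]` (conjugation commutes with the pull-back and with `e ⊗ ℂ`), so the
pull-back of `σ̄ ∪ σ` is `|s|² (e ⊗ ℂ)[η̄ ∧ η]` (`complexifyFun_mk_wedge`). If it vanished,
`η̄ ∧ η = η ∧ η̄` would be exact, hence so would be the real top form `Re(c₀ η ∧ η̄)`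
(`c₀ = \overline{(-2i)²}`); but that form is `|η(e)|² ψ₀` pointwise with `ψ₀(e, ie) = 16 > 0`
(`ComplexFormsTopType`), so its integral for the complex orientation is positive
(`re_smul_wedge_conj_not_mem_exactSmoothForms`, the argument of the tree's
`Voisin2002_closedForm_top_zero_not_exact_holds` run for a non-zero `(n,0)`-form that need not be
exact itself), contradicting Stokes (`MForm.integral_eq_zero_of_mem_exactSmoothForms_holds`).

Everything is proved; no named facts.

## References

* [Huybrechts2016K3] D. Huybrechts, *Lectures on K3 Surfaces*, CUP 2016, Ch. 3 Example 1.7 (ii); Ch. 6 §1.1 Prop. 1.2 (ii), (iii) (PDF pp. 53, 117 of the held copy).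
* [VoisinHodgeI2002] C. Voisin, *Hodge Theory and Complex Algebraic Geometry I*, CUP 2002, §6.1.3 Cor. 6.12, §6.3.2, Prop. 7.5 / Cor. 7.6.
* [LeeSmoothManifolds2013] J. M. Lee, *Introduction to Smooth Manifolds*, 2nd ed., Prop. 16.6, Cor. 16.13.
-/

noncomputable section

open scoped Manifold ContDiff Topology
open Set Function Filter MeasureTheory Module

namespace Literature.AlgebraicGeometry.HodgeTheory

/-! ### `∫ Re(c₀ η ∧ η̄) > 0` for a non-zero form of top type: `Re(c₀ η ∧ η̄)` is not exact -/

section TopFormPositivity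

variable {E : Type*} [NormedAddCommGroup E] [NormedSpace ℂ E] [FiniteDimensional ℂ E]
  {M : Type*} [TopologicalSpace M] [ChartedSpace E M] [IsManifold 𝓘(ℂ, E) ω M] [IsManifold 𝓘(ℝ, E) ∞ M]
  [CompactSpace M] [T2Space M] {m : ℕ}

/-- **For a non-zero smooth form `η` of top type `(n,0)` on a compact complex `n`-fold, the real top
form `Re(c₀ · η ∧ η̄)` (`c₀ = \overline{(-2i)ⁿ}`) is not exact**: pointwise `η = η(e) det_e`
(`IsOfType.apply_eq_smul_cdetL`), so `Re(c₀ η ∧ η̄) = |η(e)|² ψ₀` with `ψ₀ = Re(c₀ det_e ∧ \overline{det_e})`,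
`ψ₀(e, ie) = 4ⁿ > 0`; every chart integrand of `∫_M` for the (constant) complex orientation is then
`≥ 0` and positive near a point where `η ≠ 0`, so `∫_M Re(c₀ η ∧ η̄) > 0`
(`integral_pos_of_chartIntegrand_nonneg`), while exact forms integrate to `0` by Stokes
(`MForm.integral_eq_zero_of_mem_exactSmoothForms_holds`). This is the argument of the tree's
`Voisin2002_closedForm_top_zero_not_exact_holds` (Voisin (2002), Prop. 7.5 / Cor. 7.6, `p = n`),
separated from the exactness of `η` itself. [cite: VoisinHodgeI2002, Prop. 7.5 and Cor. 7.6 (p = n)]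
[cite: LeeSmoothManifolds2013, Prop. 16.6 and Cor. 16.13] -/
theorem re_smul_wedge_conj_not_mem_exactSmoothForms (hn : finrank ℂ E = m + 1)
    {η : Literature.Geometry.Kaehler.MForm 𝓘(ℝ, E) M ℂ (m + 1)} (hηs : Literature.Geometry.Kaehler.IsSmoothForm η)
    (hηt : Literature.NumberTheory.Transcendental.IsOfType (m + 1) 0 η) (hη0 : η ≠ 0) :
    (starRingEnd ℂ ((-2 * Complex.I) ^ (m + 1)) • (η.wedge η.conj)).re ∉
      Literature.Geometry.Kaehler.exactSmoothForms 𝓘(ℝ, E) M ℝ ((m + 1) + (m + 1)) := by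
  intro hΩex'
  classical
  -- measurable structure and real dimension of the model
  letI : MeasurableSpace E := borel E
  haveI : BorelSpace E := ⟨rfl⟩
  haveI hfact : Fact (finrank ℝ E = (m + 1) + (m + 1)) :=
    ⟨by rw [finrank_real_of_complex, hn, two_mul]⟩
  -- notation
  set mb := Literature.NumberTheory.Transcendental.modelBasis E ((m + 1) + (m + 1)) with hmb
  set ρ := Literature.NumberTheory.Transcendental.chartPartitionOfUnity 𝓘(ℝ, E) M with hρ
  have hηs' : Literature.Geometry.Kaehler.IsSmoothForm η := hηs
  have hηcs : Literature.Geometry.Kaehler.IsSmoothForm η.conj :=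
    Literature.NumberTheory.Transcendental.isSmoothForm_conj hηs'
  -- a complex basis, the reference top form `ψ₀ = Re(c₀ det ∧ conj det)` and the orientation
  obtain ⟨e⟩ : Nonempty (Module.Basis (Fin (m + 1)) ℂ E) := ⟨Module.finBasisOfFinrankEq ℂ E hn⟩
  obtain ⟨c₀, hc₀⟩ : ∃ c₀ : ℂ, c₀ = starRingEnd ℂ ((-2 * Complex.I) ^ (m + 1)) := ⟨_, rfl⟩
  obtain ⟨ψ₀, hψ₀⟩ : ∃ ψ₀ : E [⋀^Fin ((m + 1) + (m + 1))]→L[ℝ] ℝ,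
      ψ₀ = Complex.reCLM.compContinuousAlternatingMap
        (c₀ • ((Literature.NumberTheory.Transcendental.cdetL e).wedge
          ((Complex.conjCLE : ℂ →L[ℝ] ℂ).compContinuousAlternatingMap
            (Literature.NumberTheory.Transcendental.cdetL e)))) := ⟨_, rfl⟩
  have hψ₀b₀ : 0 < ψ₀ (Fin.append e (fun j ↦ Complex.I • e j)) := by
    rw [hψ₀, hc₀]
    exact Literature.NumberTheory.Transcendental.reCLM_wedge_conj_cdetL_apply_append_pos e
  have hψ₀ne : ψ₀.toAlternatingMap ≠ 0 := fun h ↦ by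
    have : ψ₀ (Fin.append e (fun j ↦ Complex.I • e j)) = 0 := by
      rw [← ContinuousAlternatingMap.coe_toAlternatingMap, h, AlternatingMap.zero_apply]
    exact hψ₀b₀.ne' this
  have hψ₀mb : ψ₀ mb ≠ 0 := apply_basis_ne_zero_of_ne_zero mb hψ₀ne
  obtain ⟨o₀, ho₀⟩ : ∃ o₀ : Orientation ℝ E (Fin ((m + 1) + (m + 1))),
      o₀ = rayOfNeZero ℝ _ hψ₀ne := ⟨_, rfl⟩
  have ho : Literature.NumberTheory.Transcendental.IsContinuousOrientation (I := 𝓘(ℝ, E)) (M := M)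
      (fun _ ↦ o₀) := isContinuousOrientation_const o₀
  obtain ⟨r, hr, hrψ⟩ : ∃ r : ℝ, 0 < r ∧ o₀.someVector = r • ψ₀.toAlternatingMap :=
    ((ray_eq_iff (Module.Ray.someVector_ne_zero o₀) hψ₀ne).1
      (by rw [Module.Ray.someVector_ray, ho₀])).exists_pos_right
        (Module.Ray.someVector_ne_zero o₀) hψ₀ne
  -- the real top form `Ω = Re(c₀ · η ∧ η̄)`
  obtain ⟨Ω, hΩ⟩ : ∃ Ω : Literature.Geometry.Kaehler.MForm 𝓘(ℝ, E) M ℝ ((m + 1) + (m + 1)),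
      Ω = (c₀ • (η.wedge
        η.conj)).re := ⟨_, rfl⟩
  have hΩex : Ω ∈ Literature.Geometry.Kaehler.exactSmoothForms 𝓘(ℝ, E) M ℝ ((m + 1) + (m + 1)) := by
    rw [hΩ, hc₀]
    exact hΩex'
  have hΩs : Literature.Geometry.Kaehler.IsSmoothForm Ω := by
    rw [hΩ]
    exact ((Literature.NumberTheory.Transcendental.IsSmoothFormWedge_holds 𝓘(ℝ, E) M ℂ hηs'
      hηcs).smul_complex c₀).re
  -- pointwise: `Ω x = |η x (e)|² ψ₀`
  have hΩx : ∀ (x : M) (v : Fin ((m + 1) + (m + 1)) → E),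
      Ω x v = Complex.normSq (η x e) * ψ₀ v := by
    intro x v
    have hw := hηt.apply_eq_smul_cdetL e x
    have key := congrArg (fun w : E [⋀^Fin ((m + 1) + (m + 1))]→L[ℝ] ℝ ↦ w v)
      (Literature.NumberTheory.Transcendental.reCLM_wedge_conj_smul_cdetL e c₀
        (η x e))
    simp only [ContinuousAlternatingMap.smul_apply, smul_eq_mul] at key
    rw [hΩ, hψ₀]
    refine Eq.trans ?_ key
    exact congrArg (fun φ : E [⋀^Fin (m + 1)]→L[ℝ] ℂ ↦
      (Complex.reCLM.compContinuousAlternatingMap (c₀ • (φ.wedge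
        ((Complex.conjCLE : ℂ →L[ℝ] ℂ).compContinuousAlternatingMap φ)))) v) hw
  -- Stokes: `∫ Ω = 0`
  have h0 : Ω.integral (fun _ ↦ o₀) = 0 :=
    Literature.Geometry.Kaehler.MForm.integral_eq_zero_of_mem_exactSmoothForms_holds
      (o := fun _ ↦ o₀) ho hΩex
  -- the chart integrands of `∫ Ω`, at the chart point of `z ∈ source`
  have hsv : Real.sign (o₀.someVector mb) = Real.sign (ψ₀ mb) := by
    rw [hrψ, AlternatingMap.smul_apply, ContinuousAlternatingMap.coe_toAlternatingMap, smul_eq_mul,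
      Literature.NumberTheory.Transcendental.real_sign_mul, Real.sign_of_pos hr, one_mul]
  have hformula : ∀ (i z : M), z ∈ (extChartAt 𝓘(ℝ, E) i).source →
      Literature.NumberTheory.Transcendental.chartSign (I := 𝓘(ℝ, E)) (M := M) (fun _ ↦ o₀) i
          (extChartAt 𝓘(ℝ, E) i z) *
        ρ i ((extChartAt 𝓘(ℝ, E) i).symm (extChartAt 𝓘(ℝ, E) i z)) *
          Ω.inChart i (extChartAt 𝓘(ℝ, E) i z) mb =
      ρ i z * LinearMap.det (tangentCoordChange 𝓘(ℝ, E) i z z : E →ₗ[ℝ] E) *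
        Complex.normSq (η z e) * |ψ₀ mb| := by
    intro i z hz
    have hin : Ω.inChart i (extChartAt 𝓘(ℝ, E) i z) mb =
        LinearMap.det (tangentCoordChange 𝓘(ℝ, E) i z z : E →ₗ[ℝ] E) * Ω z mb := by
      rw [Literature.Geometry.Kaehler.MForm.inChart_eq_of_mem_target _
          ((extChartAt 𝓘(ℝ, E) i).map_source hz),
        (extChartAt 𝓘(ℝ, E) i).left_inv hz, ContinuousAlternatingMap.compContinuousLinearMap_apply]
      exact Literature.NumberTheory.Transcendental.ContinuousAlternatingMap.apply_comp_eq_det_mul mb _ _ _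
    rw [chartSign_const_extChartAt o₀ hz, hsv, hin, (extChartAt 𝓘(ℝ, E) i).left_inv hz, hΩx z mb,
      ← Literature.NumberTheory.Transcendental.real_sign_mul_self (ψ₀ mb)]
    ring
  -- positivity: `0 < ∫ Ω`
  have hpos : 0 < Ω.integral (fun _ ↦ o₀) := by
    refine integral_pos_of_chartIntegrand_nonneg ho hΩs (fun i y hy ↦ ?_) ?_
    · have hz : (extChartAt 𝓘(ℝ, E) i).symm y ∈ (extChartAt 𝓘(ℝ, E) i).source :=
        (extChartAt 𝓘(ℝ, E) i).map_target hy
      rw [← (extChartAt 𝓘(ℝ, E) i).right_inv hy, hformula i _ hz]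
      exact mul_nonneg (mul_nonneg (mul_nonneg (ρ.nonneg i _)
        (det_tangentCoordChange_self_pos (M := M) i hz).le) (Complex.normSq_nonneg _)) (abs_nonneg _)
    · obtain ⟨x₀, hx₀⟩ : ∃ x₀, η x₀ ≠ 0 := Function.ne_iff.1 hη0
      have hsum := ρ.sum_eq_one (Set.mem_univ x₀)
      obtain ⟨i₀, hi₀⟩ : ∃ i₀, ρ i₀ x₀ ≠ 0 := by
        by_contra h
        push Not at h
        rw [finsum_congr h, finsum_zero] at hsum
        exact zero_ne_one hsum
      have hρpos : 0 < ρ i₀ x₀ := lt_of_le_of_ne (ρ.nonneg i₀ x₀) (Ne.symm hi₀)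
      have hxs : x₀ ∈ (extChartAt 𝓘(ℝ, E) i₀).source := by
        rw [extChartAt_source]
        exact Literature.NumberTheory.Transcendental.chartPartitionOfUnity_isSubordinate i₀
          (subset_tsupport _ hi₀)
      have hηe : η x₀ e ≠ 0 := by
        intro h0e
        apply hx₀
        have hw := hηt.apply_eq_smul_cdetL e x₀
        rw [h0e] at hw
        exact hw.trans (zero_smul ℂ _)
      refine ⟨i₀, extChartAt 𝓘(ℝ, E) i₀ x₀, (extChartAt 𝓘(ℝ, E) i₀).map_source hxs, ?_⟩
      rw [hformula i₀ _ hxs]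
      exact mul_pos (mul_pos (mul_pos hρpos (det_tangentCoordChange_self_pos (M := M) i₀ hxs))
        (Complex.normSq_pos.2 hηe)) (abs_pos.2 hψ₀mb)
  exact absurd h0 hpos.ne'


end TopFormPositivity

end Literature.AlgebraicGeometry.HodgeTheory

/-! ### K3 surfaces: `σ̄ ∪ σ ≠ 0` for `0 ≠ σ ∈ H^{2,0}`, and the discharge -/

namespace Literature.AlgebraicGeometry.Surfaces

open Literature.AlgebraicTopology.SingularHomology Literature.AlgebraicGeometry.HodgeTheory
  Literature.Geometry.Kaehler Literature.NumberTheory.Transcendental Literature.Geometry.Manifold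

variable {S : Motives.SchemeOver ℂ}

/-- **The Hodge–Riemann inequality on `H^{2,0}` of a K3 surface, sign-free form**: for a non-zero
class `σ` of Hodge type `(2,0)`, `σ̄ ∪ σ ≠ 0` in `H⁴(S(ℂ); ℂ)` (Huybrechts Ch. 6 Prop. 1.2 (ii):
"`(σ.σ̄) > 0`"; Ch. 3 Example 1.7 (ii): `-∫ v ∧ w` is negative definite on the real part of
`H^{2,0} ⊕ H^{0,2}`; Voisin I §6.3.2). See the module docstring for the proof.
[cite: Huybrechts2016K3, Ch. 6 Prop. 1.2 (ii) and Ch. 3 Example 1.7 (ii)] [cite: VoisinHodgeI2002, §6.3.2 and Cor. 7.6] -/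
theorem IsK3Surface.cupProduct_conjClass_self_ne_zero (hS : IsK3Surface S) {σ : complexBetti S (2 * 1)}
    (hσ : IsOfHodgeType 2 S (2 * 1) 2 0 σ) (hσ0 : σ ≠ 0) :
    cupProduct (rfl : 2 * 1 + 2 * 1 = 2 * 2) (conjClass (Motives.ComplexPoints S) (2 * 1) σ) σ ≠ 0 := by
  have hX := hS.isSmoothProjective
  obtain ⟨A, η, hη, hη0⟩ := hS.exists_holomorphicTwoForm_ne_zero
  -- topology and dimension of the model
  haveI : CompactSpace A.carrier := by
    haveI : AlgebraicGeometry.IsProper S.hom := Motives.IsSmoothProjective.isProper_holds hX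
    haveI : CompactSpace (Motives.ComplexPoints S) :=
      Motives.compactSpace_algPoints_of_isProper_holds S ℂ
    exact A.isAnalytification.homeomorph.symm.compactSpace
  haveI : ConnectedSpace A.carrier := A.connectedSpace_carrier hX
  haveI : WedgeFacts 𝓘(ℝ, A.model) A.carrier ℝ :=
    wedgeFacts_of_assoc 𝓘(ℝ, A.model) A.carrier ℝ (ContinuousAlternatingMap.WedgeAssoc_holds ℝ A.model ℝ)
  haveI : WedgeFacts 𝓘(ℝ, A.model) A.carrier ℂ :=
    wedgeFacts_of_assoc 𝓘(ℝ, A.model) A.carrier ℂ (ContinuousAlternatingMap.WedgeAssoc_holds ℝ A.model ℂ)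
  have h2 : Module.finrank ℂ A.model = 2 := A.isAnalytification.finrank_eq
  -- ### the real multiplicative model `A'`
  set e : DeRhamIsoFamily 𝓘(ℝ, A.model) := integrationDeRhamIsoFamily A.model with he_def
  have hem : e.IsMultiplicative := he_def ▸ integrationDeRhamIsoFamily_isMultiplicative (E := A.model)
  let A' : HodgeModel 2 S :=
    { A with
      deRham := e.complexify
      deRham_isNatural := DeRhamIsoFamily.complexify_isNatural integrationDeRhamIsoFamily_isNatural }
  -- ### the line `H^{2,0} = ℂ[η]` of the model
  have hηZ : η ∈ cclosedSmoothForms A.model A.carrier (2 * 1) := hη.mem_cclosedSmoothForms h2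
  have hηcZ : η.conj ∈ cclosedSmoothForms A.model A.carrier (2 * 1) := conj_mem_cclosedSmoothForms_holds hηZ
  set ηc : cclosedSmoothForms A.model A.carrier (2 * 1) := ⟨η, hηZ⟩ with hηc_def
  set ηb : cclosedSmoothForms A.model A.carrier (2 * 1) := ⟨η.conj, hηcZ⟩ with hηb_def
  have hK : ∀ y ∈ hodgePQ A.model A.carrier (2 * 1) 2 0,
      ∃ t : ℂ, y = t • complexDeRhamCohomology.mk A.model A.carrier (2 * 1) ηc := by
    intro y hy
    induction hy using Submodule.span_induction with
    | mem y hy =>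
      obtain ⟨β, hβt, rfl⟩ := hy
      obtain ⟨hβs, hβc⟩ :=
        (mem_cclosedSmoothForms_iff (β : MForm 𝓘(ℝ, A.model) A.carrier ℂ (2 * 1))).1 β.2
      obtain ⟨t, ht⟩ := TwoForms.exists_eq_const_smul h2 hη hη0 hβs hβc hβt
      refine ⟨t, ?_⟩
      rw [← map_smul]
      congr 1
      exact Subtype.ext ht
    | zero => exact ⟨0, by rw [zero_smul]⟩
    | add y z _ _ hy hz =>
      obtain ⟨s, rfl⟩ := hy
      obtain ⟨t, rfl⟩ := hz
      exact ⟨s + t, by rw [add_smul]⟩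
    | smul a y _ hy =>
      obtain ⟨t, rfl⟩ := hy
      exact ⟨a * t, by rw [mul_smul]⟩
  -- ### read `σ` and `σ̄` in `A'`
  have hσA : A'.pullback (2 * 1) σ ∈ A'.hodgePQ (2 * 1) 2 0 := (isOfHodgeType_iff_mem_hodgePQ hX A' σ).1 hσ
  change A'.pullback (2 * 1) σ ∈ (hodgePQ A.model A.carrier (2 * 1) 2 0).map
    (e.complexifyEquiv A.carrier (2 * 1)).toLinearMap at hσA
  obtain ⟨y, hy, hyσ⟩ := Submodule.mem_map.1 hσA
  obtain ⟨s, rfl⟩ := hK y hy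
  rw [LinearEquiv.coe_coe, complexifyEquiv_apply] at hyσ
  -- `hyσ : (e ⊗ ℂ) (s • [η]) = A'^* σ`
  have hs0 : s ≠ 0 := by
    rintro rfl
    apply hσ0
    apply A'.pullback_injective (2 * 1)
    rw [← hyσ, zero_smul, map_zero]
    exact (e.complexifyEquiv A.carrier (2 * 1)).map_zero
  have hconj : A'.pullback (2 * 1) (conjClass (Motives.ComplexPoints S) (2 * 1) σ) =
      complexifyFun e (2 * 1) (starRingEnd ℂ s • complexDeRhamCohomology.mk A.model A.carrier (2 * 1) ηb) := by
    rw [A'.pullback_conjClass, ← hyσ, conjClass_complexifyFun, map_smulₛₗ, complexDeRhamCohomology.conj_mk]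
  -- ### the cup product in `A'`: `A'^*(σ̄ ∪ σ) = |s|² (e ⊗ ℂ)[η̄ ∧ η]`
  intro hcup0
  have hpull := cupProduct_map
    (⟨A'.toComplexPoints, A'.isAnalytification.isHomeomorph.continuous⟩ : C(A'.carrier, Motives.ComplexPoints S))
    (rfl : 2 * 1 + 2 * 1 = 2 * 2) (conjClass (Motives.ComplexPoints S) (2 * 1) σ) σ
  change A'.pullback (2 * 2) _ = cupProduct rfl (A'.pullback (2 * 1) _) (A'.pullback (2 * 1) σ) at hpull
  rw [hcup0, map_zero, hconj, ← hyσ, complexifyFun_smul, complexifyFun_smul, map_smul, map_smul,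
    LinearMap.smul_apply] at hpull
  have hw : cupProduct (rfl : 2 * 1 + 2 * 1 = 2 * 2)
      (complexifyFun e (2 * 1) (complexDeRhamCohomology.mk A.model A.carrier (2 * 1) ηb))
      (complexifyFun e (2 * 1) (complexDeRhamCohomology.mk A.model A.carrier (2 * 1) ηc)) =
      complexifyFun e (2 * 1 + 2 * 1) (complexDeRhamCohomology.mk A.model A.carrier (2 * 1 + 2 * 1)
        ⟨(η.conj).wedge η, wedge_mem_cclosedSmoothForms hηcZ hηZ⟩) :=
    (complexifyFun_mk_wedge hem ηb ηc).symm
  rw [hw] at hpull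
  have hzero : complexDeRhamCohomology.mk A.model A.carrier (2 * 1 + 2 * 1)
      ⟨(η.conj).wedge η, wedge_mem_cclosedSmoothForms hηcZ hηZ⟩ = 0 := by
    have h := hpull.symm
    rw [smul_eq_zero, smul_eq_zero] at h
    rcases h with h | h | h
    · exact absurd h hs0
    · exact absurd h ((map_ne_zero_iff (starRingEnd ℂ) (RingHom.injective _)).2 hs0)
    · exact (e.complexifyEquiv A.carrier (2 * 1 + 2 * 1)).map_eq_zero_iff.1 h
  -- ### `η̄ ∧ η = η ∧ η̄` is exact, hence so is `Re(c₀ η ∧ η̄)` — contradiction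
  have hex : (η.conj).wedge η ∈ cexactSmoothForms A.model A.carrier (2 * 1 + 2 * 1) := by
    have h := (complexDeRhamCohomology.mk_eq_mk_iff _ (0 : cclosedSmoothForms A.model A.carrier (2 * 1 + 2 * 1))).1
      (hzero.trans (map_zero _).symm)
    rwa [Submodule.coe_zero, sub_zero] at h
  obtain ⟨β, hβ, hβd⟩ := exists_eq_mextDeriv_of_mem_cexactSmoothForms hex
  have hcomm : η.wedge η.conj = (η.conj).wedge η := by
    rw [MForm.wedge_comm (I := 𝓘(ℝ, A.model)) (M := A.carrier) (A := ℂ) η.conj η]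
    norm_num
  have hηne : η ≠ 0 := by
    obtain ⟨x⟩ := (inferInstance : Nonempty A.carrier)
    intro h0
    exact hη0 x (by rw [h0]; rfl)
  refine re_smul_wedge_conj_not_mem_exactSmoothForms (M := A.carrier) (m := 1) (by rw [h2]) hη.isSmoothForm
    hη.isOfType hηne ?_
  rw [hcomm, hβd, ← mextDeriv_smul_complex_holds]
  exact re_mextDeriv_mem_exactSmoothForms (hβ.smul_complex _)

/-- Closed form of the Hodge–Riemann input `hHR` of `Huybrechts_K3_hodgeTypes_H2_of_hodgeRiemann`.
[cite: Huybrechts2016K3, Ch. 6 Prop. 1.2 (ii) and Ch. 3 Example 1.7 (ii)] -/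
theorem Huybrechts_K3_hodgeRiemann_twoZero :
    ∀ (S : Motives.SchemeOver ℂ), IsK3Surface S →
      ∀ σ : complexBetti S (2 * 1), IsOfHodgeType 2 S (2 * 1) 2 0 σ → σ ≠ 0 →
        cupProduct (rfl : 2 * 1 + 2 * 1 = 2 * 2) (conjClass (Motives.ComplexPoints S) (2 * 1) σ) σ ≠ 0 :=
  fun _ hS _ hσ hσ0 ↦ hS.cupProduct_conjClass_self_ne_zero hσ hσ0

/-- **`Huybrechts_K3_hodgeTypes_H2` holds** (Huybrechts, *Lectures on K3 Surfaces*, Ch. 6 Prop. 1.2 /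
Ch. 3 §1.1: for a K3 surface with `0 ≠ σ ∈ H^{2,0}`, `H^{2,0} = ℂσ`, `H^{0,2} = ℂσ̄`,
`H^{1,1} = (ℂσ ⊕ ℂσ̄)^⊥`): assembled from `h^{2,0} ≤ 1` (`Huybrechts_K3_twoZero_line`), the
bigrading of the cup product (`Huybrechts_K3_hodgeTypes_H2_of_hodgeRiemann`, fed with de Rham's theorem in
multiplicative form `exists_deRhamIsoFamily_holds`) and the Hodge–Riemann inequality `σ̄ ∪ σ ≠ 0`
(`IsK3Surface.cupProduct_conjClass_self_ne_zero`). [cite: Huybrechts2016K3, Ch. 6 Prop. 1.2 (ii), (iii) and Ch. 3 §1.1] -/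
theorem Huybrechts_K3_hodgeTypes_H2_holds : Huybrechts_K3_hodgeTypes_H2 :=
  Huybrechts_K3_hodgeTypes_H2_of_hodgeRiemann (fun E _ _ _ ↦ exists_deRhamIsoFamily_holds (E := E))
    Huybrechts_K3_hodgeRiemann_twoZero

end Literature.AlgebraicGeometry.Surfaces
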